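import Summits.Ventures.Crystal3D.Theorems.StickyWulffConstantStackingLiminfRefinedArith
import HarnessLib

/-!
# The δ-generalised per-interface calibration lemma (cf-p2 R20 blueprint L3) for the layer-profile
# ladder toward `StackingLiminf` (stmt-Ventures-19145)

Route `StickyWulffConstant` of the venture `Summits/Ventures/Crystal3D` (cell `crystal3d-full`).
Companion of `interface_calibration` (`…RefinedArith.lean`, wulff-p2): the same weak-duality step per
interface, but with natural-number layer sizes, the shallow interface bound carrying `− δ`
(as delivered by `layerProfileSharp`: `(1/2)|Δn| + √2·√max ≤ b + 1/2`), and the weight obeying the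
CAP `θ x ≤ 1 − δ/(c√x)` on `1 ≤ x ≤ M`, under `δ(2 + c/2) ≤ c²`.  Planner's proof
(`HOME/cf-p2/OptimalCalibrationSketch.lean`, cf-p2 g10), landed verbatim by eng.
WHAT THIS IS NOT: no statement about the crux; rung F-C1 not moved.
-/

noncomputable section

namespace Summit.Ventures.Crystal3D.Theorems.OptimalCalibration

open Finset

/-! ### L3 — the δ-generalised calibration lemma (abstract form, natural-number layer sizes) -/

/-- **Per-interface calibration with a cap** (blueprint L3).  Layer sizes `p q : ℕ` in `[0, M]`,
interface cost `β` with `(3/2)|p−q| ≤ β` and `(1/2)|p−q| + c√(max p q) − δ ≤ β`; a dual triple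
`θ, Ψ, Ψ₂ : ℕ → ℝ` with `0 ≤ θ`, the CAP `θ x ≤ 1 − δ/(c√x)` for `1 ≤ x ≤ M`,
`θ x (y − x) ≤ Ψ y − Ψ x` (`x ≤ y ≤ M`), `Ψ₂ x ≤ c θ x √x`, and `G = 3x/2 − Ψ − Ψ₂/2` monotone on
`[0, M]`; parameters `0 < c`, `0 ≤ δ`, `δ(2 + c/2) ≤ c²`.  Then
`Ψ₂ p/2 + Ψ₂ q/2 + |G p − G q| ≤ β`. -/
theorem interface_calibration_cap {c δ β : ℝ} {M p q : ℕ} {θ Ψ Ψ₂ : ℕ → ℝ}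
    (hc : 0 < c) (hδ : 0 ≤ δ) (hδc : δ * (2 + c / 2) ≤ c ^ 2)
    (hpM : p ≤ M) (hqM : q ≤ M)
    (hθ0 : ∀ x, 0 ≤ θ x)
    (hcap : ∀ x, 1 ≤ x → x ≤ M → θ x ≤ 1 - δ / (c * Real.sqrt x))
    (hΨ : ∀ x y, x ≤ y → y ≤ M → θ x * ((y : ℝ) - x) ≤ Ψ y - Ψ x)
    (hΨ₂ : ∀ x, Ψ₂ x ≤ c * θ x * Real.sqrt x)
    (hG : ∀ x y, x ≤ y → y ≤ M →
      3 / 2 * (x : ℝ) - Ψ x - Ψ₂ x / 2 ≤ 3 / 2 * (y : ℝ) - Ψ y - Ψ₂ y / 2)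
    (hβ1 : 3 / 2 * |(p : ℝ) - q| ≤ β)
    (hβ2 : 1 / 2 * |(p : ℝ) - q| + c * Real.sqrt (max (p : ℝ) q) - δ ≤ β) :
    Ψ₂ p / 2 + Ψ₂ q / 2 +
      |(3 / 2 * (p : ℝ) - Ψ p - Ψ₂ p / 2) - (3 / 2 * (q : ℝ) - Ψ q - Ψ₂ q / 2)| ≤ β := by
  -- ordered case `q ≤ p`
  have key : ∀ p q : ℕ, q ≤ p → p ≤ M → 3 / 2 * ((p : ℝ) - q) ≤ β →
      1 / 2 * ((p : ℝ) - q) + c * Real.sqrt p - δ ≤ β →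
      Ψ₂ p / 2 + Ψ₂ q / 2 +
        ((3 / 2 * (p : ℝ) - Ψ p - Ψ₂ p / 2) - (3 / 2 * (q : ℝ) - Ψ q - Ψ₂ q / 2)) ≤ β := by
    intro p q hqp hpM h1 h2
    have hqp' : (q : ℝ) ≤ p := by exact_mod_cast hqp
    have hθq0 := hθ0 q
    have hψ := hΨ q p hqp hpM
    have hψ₂ := hΨ₂ q
    have hsq : 0 ≤ Real.sqrt q := Real.sqrt_nonneg _
    have hsp : 0 ≤ Real.sqrt p := Real.sqrt_nonneg _
    set D : ℝ := (p : ℝ) - q with hD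
    have hD0 : 0 ≤ D := by rw [hD]; linarith
    -- LHS ≤ 3D/2 + θ q (c√q − D)
    have hL : Ψ₂ p / 2 + Ψ₂ q / 2 +
        ((3 / 2 * (p : ℝ) - Ψ p - Ψ₂ p / 2) - (3 / 2 * (q : ℝ) - Ψ q - Ψ₂ q / 2)) ≤
        3 / 2 * D + θ q * (c * Real.sqrt q - D) := by
      rw [hD]; nlinarith
    rcases le_or_gt (c * Real.sqrt q) D with hcase | hcase
    · -- steep
      have : θ q * (c * Real.sqrt q - D) ≤ 0 :=
        mul_nonpos_of_nonneg_of_nonpos hθq0 (by linarith)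
      linarith
    · -- shallow: `D < c√q`, hence `q ≥ 1`
      have hq1 : 1 ≤ q := by
        rcases Nat.eq_zero_or_pos q with rfl | hq
        · exfalso; simp at hcase; linarith
        · exact hq
      have hq1' : (1 : ℝ) ≤ q := by exact_mod_cast hq1
      have hsq1 : 1 ≤ Real.sqrt q := by
        rw [show (1 : ℝ) = Real.sqrt 1 from Real.sqrt_one.symm]
        exact Real.sqrt_le_sqrt hq1'
      have hsqpos : 0 < Real.sqrt q := by linarith
      have hcq : θ q ≤ 1 - δ / (c * Real.sqrt q) := hcap q hq1 (hqp.trans hpM)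
      -- `√p ≤ √q + c/2` from `p < q + c√q ≤ (√q + c/2)²`
      have hsqq : Real.sqrt q * Real.sqrt q = q := Real.mul_self_sqrt (by positivity)
      have hspp : Real.sqrt p * Real.sqrt p = p := Real.mul_self_sqrt (by positivity)
      have hp_le : (p : ℝ) ≤ (Real.sqrt q + c / 2) ^ 2 := by nlinarith
      have hsp_le : Real.sqrt p ≤ Real.sqrt q + c / 2 := by
        have h := Real.sqrt_le_sqrt hp_le
        rwa [Real.sqrt_sq (by positivity)] at h
      -- the side condition `δ(√p + √q) ≤ c²√q`
      have hside : δ * (Real.sqrt p + Real.sqrt q) ≤ c ^ 2 * Real.sqrt q := by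
        have h3 : δ * (Real.sqrt p + Real.sqrt q) ≤ δ * (2 * Real.sqrt q + c / 2) :=
          mul_le_mul_of_nonneg_left (by linarith) hδ
        have hA : 0 ≤ c ^ 2 - 2 * δ := by nlinarith
        have hB : 0 ≤ (c ^ 2 - 2 * δ) * (Real.sqrt q - 1) := mul_nonneg hA (by linarith)
        nlinarith
      -- `δ·D ≤ c²√q(√p − √q)` : multiply `hside` by `√p − √q ≥ 0` and use `(√p+√q)(√p−√q) = D`
      have hd : 0 ≤ Real.sqrt p - Real.sqrt q := sub_nonneg.2 (Real.sqrt_le_sqrt hqp')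
      have hdiff : (Real.sqrt p + Real.sqrt q) * (Real.sqrt p - Real.sqrt q) = D := by
        have e : (Real.sqrt p + Real.sqrt q) * (Real.sqrt p - Real.sqrt q) =
            Real.sqrt p * Real.sqrt p - Real.sqrt q * Real.sqrt q := by ring
        rw [e, hspp, hsqq, hD]
      have hmain : δ * D ≤ c ^ 2 * Real.sqrt q * (Real.sqrt p - Real.sqrt q) := by
        have h4 := mul_le_mul_of_nonneg_right hside hd
        calc δ * D = δ * (Real.sqrt p + Real.sqrt q) * (Real.sqrt p - Real.sqrt q) := by
              rw [← hdiff]; ring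
          _ ≤ c ^ 2 * Real.sqrt q * (Real.sqrt p - Real.sqrt q) := h4
      -- θ q (c√q − D) ≤ (1 − δ/(c√q))(c√q − D) = c√q − D − δ + (δ/(c√q)) D
      have hpos : 0 < c * Real.sqrt q - D := by linarith
      have h5 : θ q * (c * Real.sqrt q - D) ≤ (1 - δ / (c * Real.sqrt q)) * (c * Real.sqrt q - D) :=
        mul_le_mul_of_nonneg_right hcq hpos.le
      have hcs : 0 < c * Real.sqrt q := by positivity
      have h6 : (1 - δ / (c * Real.sqrt q)) * (c * Real.sqrt q - D) =
          c * Real.sqrt q - D - δ + δ * D / (c * Real.sqrt q) := by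
        field_simp
        ring
      -- `δ D/(c√q) ≤ c(√p − √q)`
      have h7 : δ * D / (c * Real.sqrt q) ≤ c * (Real.sqrt p - Real.sqrt q) := by
        rw [div_le_iff₀ hcs]
        have e : c * (Real.sqrt p - Real.sqrt q) * (c * Real.sqrt q) =
            c ^ 2 * Real.sqrt q * (Real.sqrt p - Real.sqrt q) := by ring
        rw [e]; exact hmain
      linarith [hL, h5, h6, h7, h2]
  rcases le_total q p with hqp | hpq
  · have hqp' : (q : ℝ) ≤ p := by exact_mod_cast hqp
    have hG' := hG q p hqp hpM
    have e1 : |(p : ℝ) - q| = p - q := abs_of_nonneg (by linarith)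
    have e2 : |(3 / 2 * (p : ℝ) - Ψ p - Ψ₂ p / 2) - (3 / 2 * (q : ℝ) - Ψ q - Ψ₂ q / 2)| =
        (3 / 2 * (p : ℝ) - Ψ p - Ψ₂ p / 2) - (3 / 2 * (q : ℝ) - Ψ q - Ψ₂ q / 2) :=
      abs_of_nonneg (by linarith)
    rw [e1] at hβ1 hβ2
    rw [max_eq_left hqp'] at hβ2
    rw [e2]
    exact key p q hqp hpM hβ1 hβ2
  · have hpq' : (p : ℝ) ≤ q := by exact_mod_cast hpq
    have hG' := hG p q hpq hqM
    have e1 : |(p : ℝ) - q| = q - p := by rw [abs_sub_comm]; exact abs_of_nonneg (by linarith)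
    have e2 : |(3 / 2 * (p : ℝ) - Ψ p - Ψ₂ p / 2) - (3 / 2 * (q : ℝ) - Ψ q - Ψ₂ q / 2)| =
        (3 / 2 * (q : ℝ) - Ψ q - Ψ₂ q / 2) - (3 / 2 * (p : ℝ) - Ψ p - Ψ₂ p / 2) := by
      rw [abs_sub_comm]; exact abs_of_nonneg (by linarith)
    rw [e1] at hβ1 hβ2
    rw [max_eq_right hpq'] at hβ2
    rw [e2]
    have := key q p hpq hqM hβ1 hβ2
    linarith


end Summit.Ventures.Crystal3D.Theorems.OptimalCalibration

end
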